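import Summits.ValiantsHypothesis.ValiantsHypothesis.Theorems.TwoAdicLadderTwoIntegralNormalisationPrecisionUniform

/-!
# PROPOSED reshaped skeleton for line `birth` of crux `TwoIntegralNormalisation` (stmt-ValiantsHypothesis-5947)

Written by the stub prover of `stub_halfElim` (val-width-5947-p1 g2, 2026-08-28) as a SUGGESTION to
the line planner / lead (this seat does not register lines). Supersedes g0's
`PROPOSED_LINE_global.lean` only in currency: the load-bearing stub is stated as EXACT DIVISION.

Rationale (crux workfile `HALFELIM-CENSUS-g2.md`): the tree now proves, unconditionally,
`TwoIntegralNormalisation ↔ HalfElimGlobal ↔ DivElimGlobal`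
(`twoIntegralNormalisation_iff_divElimGlobal`, `…PrecisionUniform.lean`). So the single open stub
below is EQUIVALENT to the crux — the reshaping is lossless — and it no longer mentions `ℂ`, number-
field circuits, finite rings, precisions, or heights of constants: it is the bare algebraic question
"can a power of `2` be divided out of a `2`-adically integral circuit for the permanent at
polynomial cost?" (global, eventually-in-`n` form). The registered UNIFORM `stub_halfElim` is the
strictly stronger `DivElimUniform` (`halfElim_iff_divElim`), not implied by VP ≠ VNP.

Stubs of the reshaped line:
* `stub_algConst` — LANDED (`…AlgConst.lean`, p573936), cited by name (not needed by the new
  composition, kept for the record: it is absorbed into `twoIntegralNormalisation_iff_divElimGlobal`).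
* `stub_divElimGlobal` — OPEN, load-bearing (the only sorry), EQUIVALENT to the crux.
* `stub_chainRingReduction` — LANDED (`…ChainRingReduction.lean`, p573293), idem.
-/

set_option linter.dupNamespace false

namespace Summit.ValiantsHypothesis.ValiantsHypothesis.Cruxes.TwoIntegralNormalisation.DivElim

open Summit.ValiantsHypothesis.ValiantsHypothesis.Theses.TwoAdicLadder
open Summit.ValiantsHypothesis.ValiantsHypothesis.Theorems.TwoAdicLadder.TwoIntegralNormalisation
open NumberField Literature.Computability.AlgebraicComplexity MvPolynomial

/-- **DivElimGlobal — exact division of the permanent by powers of `2` over `2`-integral number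
rings, global form** (proposed load-bearing stub; EQUIVALENT to the crux by
`twoIntegralNormalisation_iff_divElimGlobal`). If for one exponent `a` and every `n` some scaled
permanent `2^M · per_n` has a circuit of size `≤ n^a + a` over the local ring `𝓞_(𝔭)` at a prime
`𝔭 ∋ 2` of some number field, then for one exponent `b` and all large `n` the permanent `per_n`
itself has a circuit of size `≤ n^b` over some such local ring. -/
def DivElimGlobal : Prop :=
  (∃ a : ℕ, ∀ n : ℕ, ∃ (K : Type) (_ : Field K) (_ : NumberField K)
      (P : Ideal (𝓞 K)) (_ : P.IsPrime), (2 : 𝓞 K) ∈ P ∧ ∃ M : ℕ,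
      complexity (C ((2 : Localization.AtPrime P) ^ M) *
        perPoly (Fin n) (Localization.AtPrime P)) ≤ n ^ a + a) →
    ∃ b : ℕ, ∀ᶠ n in Filter.atTop, ∃ (K' : Type) (_ : Field K') (_ : NumberField K')
      (P : Ideal (𝓞 K')) (_ : P.IsPrime), (2 : 𝓞 K') ∈ P ∧
      complexity (perPoly (Fin n) (Localization.AtPrime P)) ≤ n ^ b

/-- Stub DivElimGlobal (proposed obligation; signature = `DivElimGlobal` verbatim). OPEN. -/
theorem stub_divElimGlobal :
    (∃ a : ℕ, ∀ n : ℕ, ∃ (K : Type) (_ : Field K) (_ : NumberField K)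
        (P : Ideal (𝓞 K)) (_ : P.IsPrime), (2 : 𝓞 K) ∈ P ∧ ∃ M : ℕ,
        complexity (C ((2 : Localization.AtPrime P) ^ M) *
          perPoly (Fin n) (Localization.AtPrime P)) ≤ n ^ a + a) →
      ∃ b : ℕ, ∀ᶠ n in Filter.atTop, ∃ (K' : Type) (_ : Field K') (_ : NumberField K')
        (P : Ideal (𝓞 K')) (_ : P.IsPrime), (2 : 𝓞 K') ∈ P ∧
        complexity (perPoly (Fin n) (Localization.AtPrime P)) ≤ n ^ b := by
  sorry

namespace Registered
/-- Alias (proposed stub). -/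
abbrev stub_divElimGlobal : Prop := DivElimGlobal
end Registered

/-- **Composition** — kernel-checked and sorry-free in the tree:
`twoIntegralNormalisation_of_divElimGlobal` (`…DivisionForm.lean`, landed stubs plugged in). -/
theorem TwoIntegralNormalisation_of : Registered.stub_divElimGlobal → TwoIntegralNormalisation :=
  fun h => twoIntegralNormalisation_of_divElimGlobal h

/-- Losslessness: the proposed stub is EQUIVALENT to the crux (tree
`twoIntegralNormalisation_iff_divElimGlobal`). -/
example : TwoIntegralNormalisation ↔ DivElimGlobal := twoIntegralNormalisation_iff_divElimGlobal

/-- Calibration: the proposed stub is implied by VP ≠ VNP (tree `divElimGlobal_of_valiantsHypothesis`). -/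
example : _root_.ValiantsHypothesis → DivElimGlobal := divElimGlobal_of_valiantsHypothesis

/-- Wiring check: the skeleton is `TwoIntegralNormalisation` closed modulo the single stub. -/
example : TwoIntegralNormalisation := TwoIntegralNormalisation_of stub_divElimGlobal

end Summit.ValiantsHypothesis.ValiantsHypothesis.Cruxes.TwoIntegralNormalisation.DivElim
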